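import Summits.BirchSwinnertonDyer.BirchSwinnertonDyer.Theorems.SignedLowerHalvesSprungLowerDivisibilityAtThreeKatoSporadicLedgerJoint
import Summits.BirchSwinnertonDyer.BirchSwinnertonDyer.Theorems.SignedLowerHalvesSprungLowerDivisibilityAtThreeIotaStability
import Summits.BirchSwinnertonDyer.BirchSwinnertonDyer.Theorems.SignedLowerHalvesSprungLowerDivisibilityAtThreeBothColours
import Summits.BirchSwinnertonDyer.BirchSwinnertonDyer.Theorems.ThetaPartnerAtTwoSignedKatoUpToAtTwoInvolFunctionalEquation
import Literature.NumberTheory.EllipticCurves.Kato2004.IwasawaInvolutionTwistProofs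
import HarnessLib

/-!
# Crux `SprungLowerDivisibilityAtThree` (item stmt-BirchSwinnertonDyer-19875), line `chromatic-common-zeros`, skeleton v8:
# the sporadic ledger of stub K_spor is `ι`-SYMMETRIC in its analytic column — `m(𝔭) = m(ι𝔭)` class-wide on X8 —
# hence on an `ι`-orbit «index symmetry `k(𝔭) = k(ι𝔭)` ⟺ local-index symmetry `j(𝔭) = j(ι𝔭)`» (STUB-PLAN §0bis,
# kernel-checked) and the ORBIT WINDOW `m ≤ k(𝔭) + k(ι𝔭)` (card k4 H-B5/H-B6)

Cell `bsd-ssimc` (host), width seat `cruxlead-stmt-BirchSwinnertonDyer-19875-w3` (gen 6) under the 19875 LEAD; `--supports`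
stmt-BirchSwinnertonDyer-19875 `--as helper`; theorems only; closes NO item. Third piece of the socket-α currency after
`…KatoSporadicLedger` (w2 g7: `m^• = k + c^•`), `…KatoSporadicLedgerJoint` (`m = k + j`, `ℓ_𝔭 Λ/(a,b) = min`) and
`…KatoSporadicLedgerDoor` (the telescope). HONEST FRAMING: structure of the open stub's currency, not progress on its
content; K_spor, K1, leaf X8 and BSD are NOT proved by anything here.

Notation at a height-one prime `𝔭` of `Λ = ℤ_p⟦T⟧`, `ι : T ↦ (1+T)⁻¹ − 1` (`IwasawaAlgebra.invol p`; `ι𝔭 :=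
PrimeSpectrum.comap ι 𝔭`, again of height one), joint ♯/♭ Coleman–Kato package `I, Cs, Cf` (`Cs.Z = Cf.Z`) of a Sprung pair
`(L♯, L♭)`: `k = ℓ_𝔭(I.H ⧸ Z)` (zeta index), `c^• = ℓ_𝔭(Λ ⧸ range C•.colMap)`, `j = min(c♯, c♭)` (local index),
`m = min(ℓ_𝔭 Λ/(G♯), ℓ_𝔭 Λ/(G♭)) = ℓ_𝔭 Λ/(L♯, L♭)` off `(p)` (common-zero multiplicity), `x = ℓ_𝔭 Y.X` (fine mass).
* §1 `lengthAt_quotient_eq_comap_invol_of_invol_mem`: for an ideal `J` with `ι(J) ⊆ J`, `ℓ_𝔭(Λ/J) = ℓ_{ι𝔭}(Λ/J)` at every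
  prime (`ι` induces a `ι`-semilinear automorphism of `Λ/J`; `Kato2004.lengthAt_eq_of_involSemilinear`).
* §2 on X8 the ideal `(L♯, L♭)` is `ι`-stable (w3 g4 `ChromaticIota.ClassX8.subst_invOnePlusSubOne_mem_of_mem`, p634976, the
  colour-MIXING functional equation), so `ℓ_𝔭 Λ/(L♯, L♭) = ℓ_{ι𝔭} Λ/(L♯, L♭)` — the common-zero MULTIPLICITY is
  `ι`-symmetric although neither colour's own zero set is.
* §3 (package algebra, `ι`-stability displayed) / §4 (X8, input-free): `k(𝔭) + j(𝔭) = k(ι𝔭) + j(ι𝔭)` off `(p)`, hence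
  `k(𝔭) = k(ι𝔭) ⟺ j(𝔭) = j(ι𝔭)`: the typed (γ-keyed) stub on a sporadic `ι`-pair = Kato's MC ∧ index symmetry, and index
  symmetry IS local-index symmetry; ORBIT WINDOW: F-α at `𝔭` (`j ≤ x`, displayed) and Kato's Thm. 13.4 in print-exact
  keying for the γ-keyed `Y` (`x(𝔭) ≤ k(ι𝔭)`, displayed) give `m(𝔭) ≤ k(𝔭) + k(ι𝔭)`.

References: [Kato2004Asterisque] Conj. 12.10, Thm. 12.6, Thm. 13.4, §17.13; [Sprung2012] Def. 6.1, §7.1, Thm. 7.14 (3); [Sprung2017]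
Thm. 4.13, Cor. 4.14; [GreenbergLNM1716] §1; [Wingberg1989] Cor. 2.5 / [Matar2020] Thm. 1.1; tree: `…IotaStability` (p634976),
`…BothColours` (p621881), `…KatoSporadicLedger` (p648387), `…KatoSporadicLedgerJoint` (p648952), `Kato2004/IwasawaInvolutionTwistProofs`.
-/

set_option linter.dupNamespace false
set_option autoImplicit false

noncomputable section

open scoped Classical NumberField MatrixGroups ModularForm

open NumberField IsDedekindDomain CongruenceSubgroup WeierstrassCurve Field
  Literature.NumberTheory.EllipticCurves Literature.NumberTheory.EllipticCurves.ModularForms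
  Literature.NumberTheory.EllipticCurves.ZpExtension Literature.NumberTheory.EllipticCurves.Sprung2017
  Literature.NumberTheory.EllipticCurves.Sprung2012 Literature.NumberTheory.EllipticCurves.Rank1Residual
  Literature.NumberTheory.EllipticCurves.IwasawaAlgebra Literature.NumberTheory.EllipticCurves.Kato2004
  Literature.NumberTheory.EllipticCurves.Module
  Summit.BirchSwinnertonDyer.BirchSwinnertonDyer.Theorems
  Summit.BirchSwinnertonDyer.BirchSwinnertonDyer.Theorems.SmallImageSignedMuDefect

namespace Summit.BirchSwinnertonDyer.BirchSwinnertonDyer.Theorems.ChromaticCommonZeros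

/-! ### §1 Pure algebra: `ℓ_𝔭(Λ/J) = ℓ_{ι𝔭}(Λ/J)` for a `ι`-stable ideal `J` -/

section Invol

variable {p : ℕ} [Fact p.Prime]

/-- A `ι`-stable ideal is `ι`-INVARIANT: `ι(J) ⊆ J ⟹ J = ι(J)` (`ι ∘ ι = id`). [cite: GreenbergLNM1716, §1] -/
theorem eq_map_involEquiv_of_invol_mem (J : Ideal (IwasawaAlgebra p)) (hJ : ∀ x ∈ J, invol p x ∈ J) :
    J = J.map ((involEquiv p : IwasawaAlgebra p ≃+* IwasawaAlgebra p) : IwasawaAlgebra p →+* IwasawaAlgebra p) := by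
  refine le_antisymm ?_ ?_
  · intro x hx
    have hx' : x = ((involEquiv p : IwasawaAlgebra p ≃+* IwasawaAlgebra p) :
        IwasawaAlgebra p →+* IwasawaAlgebra p) (invol p x) := by
      change x = involEquiv p (invol p x)
      rw [involEquiv_apply, invol_invol]
    rw [hx']
    exact Ideal.mem_map_of_mem _ (hJ x hx)
  · rw [Ideal.map_le_iff_le_comap]
    intro x hx
    rw [Ideal.mem_comap]
    exact hJ x hx

/-- **Local lengths of `Λ/J` are `ι`-symmetric for a `ι`-stable ideal `J`:** `ℓ_𝔭(Λ/J) = ℓ_{ι𝔭}(Λ/J)` at every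
prime `𝔭`, `ι𝔭 = PrimeSpectrum.comap ι 𝔭` — the ring automorphism `ι` induces a `ι`-semilinear additive automorphism of
`Λ/J`, and local lengths are invariant under semilinear equivalences (`Kato2004.lengthAt_eq_of_involSemilinear`).
[cite: GreenbergLNM1716, §1 (p. 60)] [cite: BourbakiAC5to7, Ch. VII §4.4] -/
theorem lengthAt_quotient_eq_comap_invol_of_invol_mem (J : Ideal (IwasawaAlgebra p))
    (hJ : ∀ x ∈ J, invol p x ∈ J) (𝔭 : PrimeSpectrum (IwasawaAlgebra p)) :
    Module.lengthAt (IwasawaAlgebra p) (IwasawaAlgebra p ⧸ J) 𝔭 =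
      Module.lengthAt (IwasawaAlgebra p) (IwasawaAlgebra p ⧸ J) (PrimeSpectrum.comap (invol p).toRingHom 𝔭) := by
  have hJJ := eq_map_involEquiv_of_invol_mem J hJ
  set e0 : (IwasawaAlgebra p ⧸ J) ≃+* (IwasawaAlgebra p ⧸ J) :=
    Ideal.quotientEquiv J J (involEquiv p : IwasawaAlgebra p ≃+* IwasawaAlgebra p) hJJ with he0
  have he : ∀ (f : IwasawaAlgebra p) (m : IwasawaAlgebra p ⧸ J),
      (e0 : (IwasawaAlgebra p ⧸ J) ≃+ (IwasawaAlgebra p ⧸ J)) (f • m) =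
        invol p f • (e0 : (IwasawaAlgebra p ⧸ J) ≃+ (IwasawaAlgebra p ⧸ J)) m := by
    have hsmul : ∀ (r y : IwasawaAlgebra p), r • Ideal.Quotient.mk J y = Ideal.Quotient.mk J (r * y) :=
      fun r y => by
        rw [← smul_eq_mul, ← Ideal.Quotient.mk_eq_mk, ← Ideal.Quotient.mk_eq_mk, Submodule.Quotient.mk_smul]
    intro f m
    obtain ⟨x, rfl⟩ := Ideal.Quotient.mk_surjective m
    change e0 (f • Ideal.Quotient.mk J x) = invol p f • e0 (Ideal.Quotient.mk J x)
    rw [hsmul, he0, Ideal.quotientEquiv_mk, Ideal.quotientEquiv_mk, hsmul]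
    change Ideal.Quotient.mk J (involEquiv p (f * x)) = Ideal.Quotient.mk J (invol p f * involEquiv p x)
    rw [map_mul, involEquiv_apply, involEquiv_apply]
  exact Kato2004.lengthAt_eq_of_involSemilinear
    (e0 : (IwasawaAlgebra p ⧸ J) ≃+ (IwasawaAlgebra p ⧸ J)) he 𝔭

end Invol

/-! ### §2 Class X8: the ideal `(L♯, L♭)` is `ι`-stable, so the common-zero multiplicity is `ι`-symmetric -/

section X8

/-- **On class X8, `ι(L♯, L♭) ⊆ (L♯, L♭)`** in the tree's `IwasawaAlgebra.invol` currency (w3 g4's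
`ChromaticIota.ClassX8.subst_invOnePlusSubOne_mem_of_mem`, p634976, through `invol p f = f.subst invOnePlusSubOne`).
INPUT-FREE. [cite: Sprung2017, Thm. 1.1, Thm. 4.13, Cor. 4.14] [cite: MazurTateTeitelbaum1986Invent, §I.17] -/
theorem ClassX8.invol_mem_span_pair (W : WeierstrassCurve ℚ) [W.IsElliptic] [W.IsGloballyMinimal] (p : ℕ)
    [Fact p.Prime] (hX : ClassX8 W p) {N : ℕ} [hN : NeZero N] (f : CuspForm (Gamma0 N) 2)
    (Lsharp Lflat : IwasawaAlgebra p) (hf : IsNewformOf W f)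
    (hSP : IsSprungPair f p (W.frobeniusTrace p) Lsharp Lflat) :
    ∀ x ∈ Ideal.span ({Lsharp, Lflat} : Set (IwasawaAlgebra p)),
      invol p x ∈ Ideal.span ({Lsharp, Lflat} : Set (IwasawaAlgebra p)) := by
  set J : Ideal (IwasawaAlgebra p) := Ideal.span ({Lsharp, Lflat} : Set (IwasawaAlgebra p)) with hJ
  have hs : Lsharp ∈ J := Ideal.subset_span (by simp)
  have hfl : Lflat ∈ J := Ideal.subset_span (by simp)
  obtain ⟨h1, h2⟩ :=
    ChromaticIota.ClassX8.subst_invOnePlusSubOne_mem_of_mem W p hX N hN f Lsharp Lflat hf hSP J hs hfl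
  have hle : J.map (invol p).toRingHom ≤ J := by
    rw [hJ, Ideal.map_span, Ideal.span_le]
    rintro _ ⟨y, hy, rfl⟩
    rcases hy with rfl | rfl
    · rw [AlgHom.toRingHom_eq_coe, RingHom.coe_coe, SignedKatoOffTwo.Invol.invol_eq_subst_invOnePlusSubOne]; exact h1
    · rw [AlgHom.toRingHom_eq_coe, RingHom.coe_coe, SignedKatoOffTwo.Invol.invol_eq_subst_invOnePlusSubOne]; exact h2
  intro x hx
  exact hle (Ideal.mem_map_of_mem (invol p).toRingHom hx)

/-- **THE COMMON-ZERO MULTIPLICITY IS `ι`-SYMMETRIC ON X8 (card k4 H-B6):** for every X8 pair, newform `f`, Sprung pair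
`(L♯, L♭)` and EVERY prime `𝔭` of `Λ`: `ℓ_𝔭 Λ/(L♯, L♭) = ℓ_{ι𝔭} Λ/(L♯, L♭)`. Class-wide, input-free. (Each colour's own
zero set is NOT `ι`-symmetric at `a₃ = ±3` — the functional equation mixes the colours; only the pair ideal is.)
[cite: Sprung2017, Thm. 4.13, Cor. 4.14] [cite: GreenbergLNM1716, §1] -/
theorem ClassX8.lengthAt_quotient_span_pair_eq_comap_invol (W : WeierstrassCurve ℚ) [W.IsElliptic]
    [W.IsGloballyMinimal] (p : ℕ) [Fact p.Prime] (hX : ClassX8 W p) {N : ℕ} [NeZero N]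
    (f : CuspForm (Gamma0 N) 2) (Lsharp Lflat : IwasawaAlgebra p) (hf : IsNewformOf W f)
    (hSP : IsSprungPair f p (W.frobeniusTrace p) Lsharp Lflat) (𝔭 : PrimeSpectrum (IwasawaAlgebra p)) :
    Module.lengthAt (IwasawaAlgebra p) (IwasawaAlgebra p ⧸ Ideal.span ({Lsharp, Lflat} : Set (IwasawaAlgebra p))) 𝔭 =
      Module.lengthAt (IwasawaAlgebra p) (IwasawaAlgebra p ⧸ Ideal.span ({Lsharp, Lflat} : Set (IwasawaAlgebra p)))
        (PrimeSpectrum.comap (invol p).toRingHom 𝔭) :=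
  lengthAt_quotient_eq_comap_invol_of_invol_mem _ (ClassX8.invol_mem_span_pair W p hX f Lsharp Lflat hf hSP) 𝔭

end X8

/-! ### §3 The ledger on an `ι`-orbit (package algebra; `ι`-stability and non-vanishing displayed) -/

section Package

variable (W : WeierstrassCurve ℚ) [W.IsElliptic] (p : ℕ) [Fact p.Prime]
  [ContinuousSMul ℤ_[p] (W.tateModule p)] [Module.Free ℤ_[p] (W.tateModule p)]
  [Module.Finite ℤ_[p] (W.tateModule p)]
  {N : ℕ} {f : CuspForm (Gamma0 N) 2} {ϖ : ℚ} {κ : ZpExtension ℚ p} {γ : absoluteGaloisGroup ℚ}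
  {E : Type} [Field E] [Algebra ℚ E] {ι : AlgebraicClosure ℚ →ₐ[ℚ] AlgebraicClosure E} {ap : ℤ}
  {g : absoluteGaloisGroup E} {c : ℕ → localPoints W E} {I : IwasawaH1Data W p κ γ}

/-- **The common-zero multiplicity in NORMALISED currency is `ℓ_𝔭 Λ/(L♯, L♭)` off `(p)`:** for `ϖ ≠ 0`, Néron-normalised
`Gs, Gf` of non-zero `L♯, L♭` and a height-one `𝔭 ∌ p`: `min(ℓ_𝔭 Λ/(Gs), ℓ_𝔭 Λ/(Gf)) = ℓ_𝔭 Λ/(L♯, L♭)` (the normalisation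
is invisible off `(p)`, w2 g7; pair length = min, `…LedgerJoint`). [cite: Sprung2012, Def. 6.1 (p. 1495)] [cite: Washington1997, §13.2] -/
theorem min_lengthAt_quotient_span_normalised_eq_lengthAt_quotient_span_pair {ϖ : ℚ} (hϖ : ϖ ≠ 0)
    {Lsharp Lflat Gs Gf : IwasawaAlgebra p} (hs0 : Lsharp ≠ 0) (hf0 : Lflat ≠ 0)
    (hGs : iwasawaToPowerSeries p Gs =
      PowerSeries.C ((ϖ : ℚ) : ℚ_[p]) * iwasawaToPowerSeries p (chromaticL Chroma.sharp Lsharp Lflat))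
    (hGf : iwasawaToPowerSeries p Gf =
      PowerSeries.C ((ϖ : ℚ) : ℚ_[p]) * iwasawaToPowerSeries p (chromaticL Chroma.flat Lsharp Lflat))
    (𝔭 : PrimeSpectrum (IwasawaAlgebra p)) (h𝔭 : 𝔭.asIdeal.height = 1)
    (hp𝔭 : (p : IwasawaAlgebra p) ∉ 𝔭.asIdeal) :
    min (Module.lengthAt (IwasawaAlgebra p) (IwasawaAlgebra p ⧸ Ideal.span {Gs}) 𝔭)
        (Module.lengthAt (IwasawaAlgebra p) (IwasawaAlgebra p ⧸ Ideal.span {Gf}) 𝔭) =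
      Module.lengthAt (IwasawaAlgebra p)
        (IwasawaAlgebra p ⧸ Ideal.span ({Lsharp, Lflat} : Set (IwasawaAlgebra p))) 𝔭 := by
  rw [chromaticL_sharp] at hGs
  rw [chromaticL_flat] at hGf
  rw [lengthAt_quotient_span_normalised_eq_of_natCast_p_not_mem hϖ hGs 𝔭 hp𝔭,
    lengthAt_quotient_span_normalised_eq_of_natCast_p_not_mem hϖ hGf 𝔭 hp𝔭,
    lengthAt_quotient_span_pair_eq_min Lsharp Lflat hs0 hf0 𝔭 h𝔭]

/-- **`k + j` IS `ι`-SYMMETRIC off `(p)` whenever `(L♯, L♭)` is `ι`-stable** (joint package, same zeta line, both colours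
non-zero and normalised, `ϖ ≠ 0`, `E[p]` irreducible; height-one `𝔭 ∌ p`):
`ℓ_𝔭(𝐇¹/Z) + min_• ℓ_𝔭(Λ/range Col^•) = ℓ_{ι𝔭}(𝐇¹/Z) + min_• ℓ_{ι𝔭}(Λ/range Col^•)` — both sides are the common-zero
multiplicity (`m = k + j`, `…LedgerJoint`), which is `ι`-symmetric (§1). [cite: Kato2004Asterisque, Thm. 12.6 (p. 222), §17.13 (p. 280)]
[cite: Sprung2012, Def. 6.1, §7.1, Thm. 7.14 (3)] [cite: GreenbergLNM1716, §1] -/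
theorem zeta_add_localIndex_eq_comap_invol_of_invol_mem
    (Cs : SharpFlatColemanKatoData W p f ϖ κ γ ι ap g c Chroma.sharp I)
    (Cf : SharpFlatColemanKatoData W p f ϖ κ γ ι ap g c Chroma.flat I) (hZ : Cs.Z = Cf.Z)
    (hirr : W.HasIrreducibleModPGaloisRep p) (hϖ : ϖ ≠ 0) {Lsharp Lflat Gs Gf : IwasawaAlgebra p}
    (hSP : IsSprungPair f p ap Lsharp Lflat) (hs0 : Lsharp ≠ 0) (hf0 : Lflat ≠ 0)
    (hGs : iwasawaToPowerSeries p Gs =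
      PowerSeries.C ((ϖ : ℚ) : ℚ_[p]) * iwasawaToPowerSeries p (chromaticL Chroma.sharp Lsharp Lflat))
    (hGf : iwasawaToPowerSeries p Gf =
      PowerSeries.C ((ϖ : ℚ) : ℚ_[p]) * iwasawaToPowerSeries p (chromaticL Chroma.flat Lsharp Lflat))
    (hJ : ∀ x ∈ Ideal.span ({Lsharp, Lflat} : Set (IwasawaAlgebra p)),
      invol p x ∈ Ideal.span ({Lsharp, Lflat} : Set (IwasawaAlgebra p)))
    (𝔭 : PrimeSpectrum (IwasawaAlgebra p)) (h𝔭 : 𝔭.asIdeal.height = 1)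
    (hp𝔭 : (p : IwasawaAlgebra p) ∉ 𝔭.asIdeal) :
    Module.lengthAt (IwasawaAlgebra p) (I.H ⧸ Cs.Z) 𝔭 +
        min (Module.lengthAt (IwasawaAlgebra p) (IwasawaAlgebra p ⧸ LinearMap.range Cs.colMap) 𝔭)
          (Module.lengthAt (IwasawaAlgebra p) (IwasawaAlgebra p ⧸ LinearMap.range Cf.colMap) 𝔭) =
      Module.lengthAt (IwasawaAlgebra p) (I.H ⧸ Cs.Z) (PrimeSpectrum.comap (invol p).toRingHom 𝔭) +
        min (Module.lengthAt (IwasawaAlgebra p) (IwasawaAlgebra p ⧸ LinearMap.range Cs.colMap)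
            (PrimeSpectrum.comap (invol p).toRingHom 𝔭))
          (Module.lengthAt (IwasawaAlgebra p) (IwasawaAlgebra p ⧸ LinearMap.range Cf.colMap)
            (PrimeSpectrum.comap (invol p).toRingHom 𝔭)) := by
  have hcs : chromaticL Chroma.sharp Lsharp Lflat ≠ 0 := by rwa [chromaticL_sharp]
  have hcf : chromaticL Chroma.flat Lsharp Lflat ≠ 0 := by rwa [chromaticL_flat]
  have h𝔮1 : (PrimeSpectrum.comap (invol p).toRingHom 𝔭).asIdeal.height = 1 := by
    rw [Kato2004.height_comap_invol, h𝔭]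
  have hp𝔮 : (p : IwasawaAlgebra p) ∉ (PrimeSpectrum.comap (invol p).toRingHom 𝔭).asIdeal := by
    rwa [PrimeSpectrum.comap_asIdeal, Ideal.mem_comap, map_natCast]
  rw [← min_lengthAt_quotient_span_eq_zeta_add_min_coker W p Cs Cf hZ hirr hSP hcs hcf hGs hGf 𝔭 h𝔭,
    ← min_lengthAt_quotient_span_eq_zeta_add_min_coker W p Cs Cf hZ hirr hSP hcs hcf hGs hGf _ h𝔮1,
    min_lengthAt_quotient_span_normalised_eq_lengthAt_quotient_span_pair p hϖ hs0 hf0 hGs hGf 𝔭 h𝔭 hp𝔭,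
    min_lengthAt_quotient_span_normalised_eq_lengthAt_quotient_span_pair p hϖ hs0 hf0 hGs hGf _ h𝔮1 hp𝔮]
  exact lengthAt_quotient_eq_comap_invol_of_invol_mem _ hJ 𝔭

/-- From `a + b = c + d` in `ℕ∞` with all four finite: `a = c ↔ b = d`. [folklore] -/
private theorem ENat.eq_iff_eq_of_add_eq_add {a b c d : ℕ∞} (h : a + b = c + d) (ha : a ≠ ⊤) (hb : b ≠ ⊤)
    (hc : c ≠ ⊤) (hd : d ≠ ⊤) : a = c ↔ b = d := by
  lift a to ℕ using ha
  lift b to ℕ using hb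
  lift c to ℕ using hc
  lift d to ℕ using hd
  have h' : a + b = c + d := by exact_mod_cast h
  constructor
  · intro hac; have hac' : a = c := by exact_mod_cast hac
    exact_mod_cast (show b = d by omega)
  · intro hbd; have hbd' : b = d := by exact_mod_cast hbd
    exact_mod_cast (show a = c by omega)

/-- **INDEX SYMMETRY ⟺ LOCAL-INDEX SYMMETRY on an `ι`-orbit** (STUB-PLAN §0bis, kernel-checked): in the situation of
`zeta_add_localIndex_eq_comap_invol_of_invol_mem` (and `Gs ≠ 0`, so all four lengths are finite), `k(𝔭) = k(ι𝔭) ⟺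
j(𝔭) = j(ι𝔭)`: the typed (γ-keyed) stub on a sporadic `ι`-pair exceeds print Kato 12.10 ⊆ by index symmetry = by
local-index symmetry. [cite: Kato2004Asterisque, Conj. 12.10 (p. 224), Thm. 12.6 (p. 222)] [cite: Sprung2012, §7.1, Thm. 7.14 (3)] -/
theorem zeta_eq_comap_invol_iff_localIndex_eq
    (Cs : SharpFlatColemanKatoData W p f ϖ κ γ ι ap g c Chroma.sharp I)
    (Cf : SharpFlatColemanKatoData W p f ϖ κ γ ι ap g c Chroma.flat I) (hZ : Cs.Z = Cf.Z)
    (hirr : W.HasIrreducibleModPGaloisRep p) (hϖ : ϖ ≠ 0) {Lsharp Lflat Gs Gf : IwasawaAlgebra p}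
    (hSP : IsSprungPair f p ap Lsharp Lflat) (hs0 : Lsharp ≠ 0) (hf0 : Lflat ≠ 0)
    (hGs : iwasawaToPowerSeries p Gs =
      PowerSeries.C ((ϖ : ℚ) : ℚ_[p]) * iwasawaToPowerSeries p (chromaticL Chroma.sharp Lsharp Lflat))
    (hGf : iwasawaToPowerSeries p Gf =
      PowerSeries.C ((ϖ : ℚ) : ℚ_[p]) * iwasawaToPowerSeries p (chromaticL Chroma.flat Lsharp Lflat))
    (hGs0 : Gs ≠ 0)
    (hJ : ∀ x ∈ Ideal.span ({Lsharp, Lflat} : Set (IwasawaAlgebra p)),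
      invol p x ∈ Ideal.span ({Lsharp, Lflat} : Set (IwasawaAlgebra p)))
    (𝔭 : PrimeSpectrum (IwasawaAlgebra p)) (h𝔭 : 𝔭.asIdeal.height = 1)
    (hp𝔭 : (p : IwasawaAlgebra p) ∉ 𝔭.asIdeal) :
    Module.lengthAt (IwasawaAlgebra p) (I.H ⧸ Cs.Z) 𝔭 =
        Module.lengthAt (IwasawaAlgebra p) (I.H ⧸ Cs.Z) (PrimeSpectrum.comap (invol p).toRingHom 𝔭) ↔
      min (Module.lengthAt (IwasawaAlgebra p) (IwasawaAlgebra p ⧸ LinearMap.range Cs.colMap) 𝔭)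
          (Module.lengthAt (IwasawaAlgebra p) (IwasawaAlgebra p ⧸ LinearMap.range Cf.colMap) 𝔭) =
        min (Module.lengthAt (IwasawaAlgebra p) (IwasawaAlgebra p ⧸ LinearMap.range Cs.colMap)
            (PrimeSpectrum.comap (invol p).toRingHom 𝔭))
          (Module.lengthAt (IwasawaAlgebra p) (IwasawaAlgebra p ⧸ LinearMap.range Cf.colMap)
            (PrimeSpectrum.comap (invol p).toRingHom 𝔭)) := by
  have h := zeta_add_localIndex_eq_comap_invol_of_invol_mem W p Cs Cf hZ hirr hϖ hSP hs0 hf0 hGs hGf hJ 𝔭 h𝔭 hp𝔭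
  have hcs : chromaticL Chroma.sharp Lsharp Lflat ≠ 0 := by rwa [chromaticL_sharp]
  have h𝔮1 : (PrimeSpectrum.comap (invol p).toRingHom 𝔭).asIdeal.height = 1 := by
    rw [Kato2004.height_comap_invol, h𝔭]
  -- finiteness: `k ≤ m♯ < ⊤` and `j ≤ c♯ ≤ m♯ < ⊤` at both primes (`Gs ≠ 0`, height one)
  have hm : ∀ 𝔯 : PrimeSpectrum (IwasawaAlgebra p), 𝔯.asIdeal.height = 1 →
      Module.lengthAt (IwasawaAlgebra p) (IwasawaAlgebra p ⧸ Ideal.span {Gs}) 𝔯 ≠ ⊤ := fun 𝔯 h𝔯 =>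
    lengthAt_ne_top_of_isTorsionBy hGs0 (isTorsionBy_quotient_span_singleton Gs) 𝔯 (le_of_eq h𝔯)
  have hk : ∀ 𝔯 : PrimeSpectrum (IwasawaAlgebra p), 𝔯.asIdeal.height = 1 →
      Module.lengthAt (IwasawaAlgebra p) (I.H ⧸ Cs.Z) 𝔯 ≠ ⊤ := fun 𝔯 h𝔯 =>
    Cs.lengthAt_quotient_zeta_ne_top W p hirr hSP hcs hGs hGs0 𝔯 h𝔯
  have hj : ∀ 𝔯 : PrimeSpectrum (IwasawaAlgebra p), 𝔯.asIdeal.height = 1 →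
      min (Module.lengthAt (IwasawaAlgebra p) (IwasawaAlgebra p ⧸ LinearMap.range Cs.colMap) 𝔯)
          (Module.lengthAt (IwasawaAlgebra p) (IwasawaAlgebra p ⧸ LinearMap.range Cf.colMap) 𝔯) ≠ ⊤ :=
    fun 𝔯 h𝔯 => ne_top_of_le_ne_top (hm 𝔯 h𝔯)
      ((min_le_left _ _).trans (Cs.lengthAt_coker_le_lengthAt_quotient_span W p hirr hSP hcs hGs 𝔯 h𝔯))
  exact ENat.eq_iff_eq_of_add_eq_add h (hk 𝔭 h𝔭) (hj 𝔭 h𝔭) (hk _ h𝔮1) (hj _ h𝔮1)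

/-- **THE ORBIT WINDOW (card k4 H-B5), print-exact keying.** Joint package at a height-one `𝔭`, both colours non-zero and
normalised, `E[p]` irreducible; DISPLAYED: (hFα) the cokernel bound `j(𝔭) ≤ x(𝔭)` (the two `ι`'s cancel for the γ-keyed `Y`,
STUB-PLAN §0bis) and (hKato) Kato's Thm. 13.4 print-exactly for the γ-keyed `Y`, at the PARTNER prime: `x(𝔭) ≤ k(ι𝔭)`. THEN
`m(𝔭) ≤ k(𝔭) + k(ι𝔭)` — a common zero of multiplicity `m` forces total zeta index `≥ m` on its `ι`-orbit («no sporadic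
common zero is invisible to Kato's zeta index»). Pure ledger arithmetic (`m = k + j`). [cite: Kato2004Asterisque, Thm. 13.4, (17.13.1) (p. 280)]
[cite: Sprung2012, §7.1, Props. 7.3/7.6] [cite: Wingberg1989, Cor. 2.5] [cite: Matar2020, Thm. 1.1] -/
theorem min_lengthAt_quotient_span_le_zeta_add_zeta_comap_invol
    (Cs : SharpFlatColemanKatoData W p f ϖ κ γ ι ap g c Chroma.sharp I)
    (Cf : SharpFlatColemanKatoData W p f ϖ κ γ ι ap g c Chroma.flat I) (hZ : Cs.Z = Cf.Z)
    (hirr : W.HasIrreducibleModPGaloisRep p) {Lsharp Lflat Gs Gf : IwasawaAlgebra p}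
    (hSP : IsSprungPair f p ap Lsharp Lflat) (hs : chromaticL Chroma.sharp Lsharp Lflat ≠ 0)
    (hf : chromaticL Chroma.flat Lsharp Lflat ≠ 0)
    (hGs : iwasawaToPowerSeries p Gs =
      PowerSeries.C ((ϖ : ℚ) : ℚ_[p]) * iwasawaToPowerSeries p (chromaticL Chroma.sharp Lsharp Lflat))
    (hGf : iwasawaToPowerSeries p Gf =
      PowerSeries.C ((ϖ : ℚ) : ℚ_[p]) * iwasawaToPowerSeries p (chromaticL Chroma.flat Lsharp Lflat))
    (Y : W.FineSelmerDualData κ γ) (𝔭 : PrimeSpectrum (IwasawaAlgebra p)) (h𝔭 : 𝔭.asIdeal.height = 1)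
    (hFα : min (Module.lengthAt (IwasawaAlgebra p) (IwasawaAlgebra p ⧸ LinearMap.range Cs.colMap) 𝔭)
        (Module.lengthAt (IwasawaAlgebra p) (IwasawaAlgebra p ⧸ LinearMap.range Cf.colMap) 𝔭) ≤
      Module.lengthAt (IwasawaAlgebra p) Y.X 𝔭)
    (hKato : Module.lengthAt (IwasawaAlgebra p) Y.X 𝔭 ≤
      Module.lengthAt (IwasawaAlgebra p) (I.H ⧸ Cs.Z) (PrimeSpectrum.comap (invol p).toRingHom 𝔭)) :
    min (Module.lengthAt (IwasawaAlgebra p) (IwasawaAlgebra p ⧸ Ideal.span {Gs}) 𝔭)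
        (Module.lengthAt (IwasawaAlgebra p) (IwasawaAlgebra p ⧸ Ideal.span {Gf}) 𝔭) ≤
      Module.lengthAt (IwasawaAlgebra p) (I.H ⧸ Cs.Z) 𝔭 +
        Module.lengthAt (IwasawaAlgebra p) (I.H ⧸ Cs.Z) (PrimeSpectrum.comap (invol p).toRingHom 𝔭) := by
  rw [min_lengthAt_quotient_span_eq_zeta_add_min_coker W p Cs Cf hZ hirr hSP hs hf hGs hGf 𝔭 h𝔭]
  gcongr
  exact hFα.trans hKato

end Package

/-! ### §4 Class X8: the same, input-free (`ι`-stability and both colours non-zero are tree theorems) -/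

/-- `ϖ ≠ 0` when `ϖ·Ω_E = Ω⁺_f` for a newform (`Ω⁺_f > 0`; private plumbing, = `IsNewformOf.periodRatio_ne_zero`).
[cite: MazurTateTeitelbaum1986Invent, §I.8 (8.6)] -/
private theorem periodRatio_ne_zero_aux {W : WeierstrassCurve ℚ} {N : ℕ} [NeZero N] {f : CuspForm (Gamma0 N) 2}
    (hf : IsNewformOf W f) {ϖ : ℚ} (hϖ : (ϖ : ℝ) * W.realPeriodRat = plusPeriod f) : ϖ ≠ 0 := by
  rintro rfl
  have hpos : 0 < plusPeriod f := IsNewform0.plusPeriod_pos_holds hf.1 hf.coeffField_eq_bot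
  rw [Rat.cast_zero, zero_mul] at hϖ
  exact hpos.ne hϖ

section X8Package

variable (W : WeierstrassCurve ℚ) [W.IsElliptic] [W.IsGloballyMinimal] (p : ℕ) [Fact p.Prime]
  [ContinuousSMul ℤ_[p] (W.tateModule p)] [Module.Free ℤ_[p] (W.tateModule p)]
  [Module.Finite ℤ_[p] (W.tateModule p)]
  {N : ℕ} [NeZero N] {f : CuspForm (Gamma0 N) 2} {ϖ : ℚ} {κ : ZpExtension ℚ p} {γ : absoluteGaloisGroup ℚ}
  {E : Type} [Field E] [Algebra ℚ E] {ι : AlgebraicClosure ℚ →ₐ[ℚ] AlgebraicClosure E}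
  {g : absoluteGaloisGroup E} {c : ℕ → localPoints W E} {I : IwasawaH1Data W p κ γ}

/-- **On class X8: `k(𝔭) + j(𝔭) = k(ι𝔭) + j(ι𝔭)` at every height-one `𝔭 ∌ p`** for the joint ♯/♭ package of an X8
pair `(W, 3)`, its newform `f` with period ratio `ϖ` (`ϖ·Ω_E = Ω⁺_f`), its Sprung pair and Néron-normalised `Gs, Gf` —
INPUT-FREE (`ι`-stability: `ClassX8.invol_mem_span_pair`; both colours non-zero: `ChromaticBothColours`; `E[3]`
irreducible: supersingular). [cite: Sprung2017, Thm. 4.13, Cor. 4.14] [cite: Kato2004Asterisque, Thm. 12.6, §17.13]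
[cite: Sprung2012, §7.1, Thm. 7.14 (3)] -/
theorem ClassX8.zeta_add_localIndex_eq_comap_invol (hX : ClassX8 W p)
    (Cs : SharpFlatColemanKatoData W p f ϖ κ γ ι (W.frobeniusTrace p) g c Chroma.sharp I)
    (Cf : SharpFlatColemanKatoData W p f ϖ κ γ ι (W.frobeniusTrace p) g c Chroma.flat I) (hZ : Cs.Z = Cf.Z)
    {Lsharp Lflat Gs Gf : IwasawaAlgebra p} (hf : IsNewformOf W f) (hϖ : (ϖ : ℝ) * W.realPeriodRat = plusPeriod f)
    (hSP : IsSprungPair f p (W.frobeniusTrace p) Lsharp Lflat)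
    (hGs : iwasawaToPowerSeries p Gs =
      PowerSeries.C ((ϖ : ℚ) : ℚ_[p]) * iwasawaToPowerSeries p (chromaticL Chroma.sharp Lsharp Lflat))
    (hGf : iwasawaToPowerSeries p Gf =
      PowerSeries.C ((ϖ : ℚ) : ℚ_[p]) * iwasawaToPowerSeries p (chromaticL Chroma.flat Lsharp Lflat))
    (𝔭 : PrimeSpectrum (IwasawaAlgebra p)) (h𝔭 : 𝔭.asIdeal.height = 1)
    (hp𝔭 : (p : IwasawaAlgebra p) ∉ 𝔭.asIdeal) :
    Module.lengthAt (IwasawaAlgebra p) (I.H ⧸ Cs.Z) 𝔭 +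
        min (Module.lengthAt (IwasawaAlgebra p) (IwasawaAlgebra p ⧸ LinearMap.range Cs.colMap) 𝔭)
          (Module.lengthAt (IwasawaAlgebra p) (IwasawaAlgebra p ⧸ LinearMap.range Cf.colMap) 𝔭) =
      Module.lengthAt (IwasawaAlgebra p) (I.H ⧸ Cs.Z) (PrimeSpectrum.comap (invol p).toRingHom 𝔭) +
        min (Module.lengthAt (IwasawaAlgebra p) (IwasawaAlgebra p ⧸ LinearMap.range Cs.colMap)
            (PrimeSpectrum.comap (invol p).toRingHom 𝔭))
          (Module.lengthAt (IwasawaAlgebra p) (IwasawaAlgebra p ⧸ LinearMap.range Cf.colMap)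
            (PrimeSpectrum.comap (invol p).toRingHom 𝔭)) := by
  obtain ⟨hs0, hf0⟩ :=
    ChromaticBothColours.ClassX8.sharp_ne_zero_and_flat_ne_zero W p hX N inferInstance f Lsharp Lflat hf hSP
  exact zeta_add_localIndex_eq_comap_invol_of_invol_mem W p Cs Cf hZ (ClassX8.irr' W p hX)
    (periodRatio_ne_zero_aux hf hϖ) hSP hs0 hf0 hGs hGf (ClassX8.invol_mem_span_pair W p hX f Lsharp Lflat hf hSP) 𝔭 h𝔭 hp𝔭

/-- **On class X8: index symmetry ⟺ local-index symmetry** at every height-one `𝔭 ∌ p` (input-free form of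
`zeta_eq_comap_invol_iff_localIndex_eq`). [cite: Kato2004Asterisque, Conj. 12.10 (p. 224), Thm. 12.6 (p. 222)]
[cite: Sprung2017, Thm. 4.13, Cor. 4.14] [cite: Sprung2012, §7.1, Thm. 7.14 (3)] -/
theorem ClassX8.zeta_eq_comap_invol_iff_localIndex_eq (hX : ClassX8 W p)
    (Cs : SharpFlatColemanKatoData W p f ϖ κ γ ι (W.frobeniusTrace p) g c Chroma.sharp I)
    (Cf : SharpFlatColemanKatoData W p f ϖ κ γ ι (W.frobeniusTrace p) g c Chroma.flat I) (hZ : Cs.Z = Cf.Z)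
    {Lsharp Lflat Gs Gf : IwasawaAlgebra p} (hf : IsNewformOf W f) (hϖ : (ϖ : ℝ) * W.realPeriodRat = plusPeriod f)
    (hSP : IsSprungPair f p (W.frobeniusTrace p) Lsharp Lflat)
    (hGs : iwasawaToPowerSeries p Gs =
      PowerSeries.C ((ϖ : ℚ) : ℚ_[p]) * iwasawaToPowerSeries p (chromaticL Chroma.sharp Lsharp Lflat))
    (hGf : iwasawaToPowerSeries p Gf =
      PowerSeries.C ((ϖ : ℚ) : ℚ_[p]) * iwasawaToPowerSeries p (chromaticL Chroma.flat Lsharp Lflat))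
    (𝔭 : PrimeSpectrum (IwasawaAlgebra p)) (h𝔭 : 𝔭.asIdeal.height = 1)
    (hp𝔭 : (p : IwasawaAlgebra p) ∉ 𝔭.asIdeal) :
    Module.lengthAt (IwasawaAlgebra p) (I.H ⧸ Cs.Z) 𝔭 =
        Module.lengthAt (IwasawaAlgebra p) (I.H ⧸ Cs.Z) (PrimeSpectrum.comap (invol p).toRingHom 𝔭) ↔
      min (Module.lengthAt (IwasawaAlgebra p) (IwasawaAlgebra p ⧸ LinearMap.range Cs.colMap) 𝔭)
          (Module.lengthAt (IwasawaAlgebra p) (IwasawaAlgebra p ⧸ LinearMap.range Cf.colMap) 𝔭) =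
        min (Module.lengthAt (IwasawaAlgebra p) (IwasawaAlgebra p ⧸ LinearMap.range Cs.colMap)
            (PrimeSpectrum.comap (invol p).toRingHom 𝔭))
          (Module.lengthAt (IwasawaAlgebra p) (IwasawaAlgebra p ⧸ LinearMap.range Cf.colMap)
            (PrimeSpectrum.comap (invol p).toRingHom 𝔭)) := by
  obtain ⟨hs0, hf0⟩ :=
    ChromaticBothColours.ClassX8.sharp_ne_zero_and_flat_ne_zero W p hX N inferInstance f Lsharp Lflat hf hSP
  have hϖ0 : ϖ ≠ 0 := periodRatio_ne_zero_aux hf hϖ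
  have hGs0 : Gs ≠ 0 := by
    intro h0
    rw [h0, map_zero, eq_comm, mul_eq_zero] at hGs
    rcases hGs with hC | hL
    · have h1 : ((ϖ : ℚ) : ℚ_[p]) = 0 := by simpa using congrArg PowerSeries.constantCoeff hC
      exact hϖ0 (by exact_mod_cast h1)
    · rw [chromaticL_sharp] at hL
      exact hs0 (iwasawaToPowerSeries_injective p (by rw [hL, map_zero]))
  exact ChromaticCommonZeros.zeta_eq_comap_invol_iff_localIndex_eq W p Cs Cf hZ (ClassX8.irr' W p hX) hϖ0 hSP hs0
    hf0 hGs hGf hGs0 (ClassX8.invol_mem_span_pair W p hX f Lsharp Lflat hf hSP) 𝔭 h𝔭 hp𝔭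

end X8Package

end Summit.BirchSwinnertonDyer.BirchSwinnertonDyer.Theorems.ChromaticCommonZeros

end
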